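import Summits.Ventures.PercRepro.GenQTraceProfileB

/-!
# PercRepro — the trace profiles, part C: the coloop classes of a trace from the flats inside it (night-4, gen 11)

The lane's generic flat row (`card_Pc_sub_le`, `GenQFlatFacts`): in a set of rank `q`, the class with `q − r` coloops
at level `k` is counted by the rank-`r` flats, `#Pc k (q − r) ≤ Σ_{s'} C(s', d − k + r)·BR r s'`, and `BR r s' ≤
C(n − s', q − r)·NR r s'` (`BR_le`).  Applied to a hyperplane trace `H ∩ G` (rank `r₀ = q − 1`, `s` points) and
summed over the `s`-point spanning traces this is the row (T7) of the two-level profile LP (sheet §65 (b) (T)): for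
`j > r₀`,

`SPm_{s, j, r₀ − r} ≤ Σ_{s'} C(s', j − r₀ + r)·C(s − s', r₀ − r)·NRsum_{s, r, s'}`,

where `NRsum_{s,r,s'}` (`nrSumM`) counts the rank-`r` flats with `s'` points in the traces (`r = 2`: the lines, `3`: the
planes, `4`: the solids, `5`: the rank-`5` flats).  The cap (T8) of the LP — a rank-`r` flat lies in at most
`C(n − s', q − 1 − r)` hyperplanes with spanning traces — is not typed here.  Imports `GenQTraceProfileB`.
-/
namespace PercRepro.Night4

open Finset ThmH SixFour GenQ PerFlat Star

variable {α : Type*} [DecidableEq α] {M : Matroid α} [M.Finite]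

/-- `NRsum_{s, r, s'}`: the rank-`r` flats with `s'` points in the `s`-point spanning traces, summed over the traces. -/
noncomputable def nrSumM (M : Matroid α) [M.Finite] (G : Finset α) (r₀ s r s' : ℕ) : ℕ :=
  ∑ H ∈ flatsTr M G r₀ s, NR M (H ∩ G) r s'

/-- The class with `r₀ − r` coloops of one trace is counted by its rank-`r` flats (the lane's `card_Pc_sub_le` with
`BR_le`, at the trace): `spFm H r₀ j (r₀ − r) ≤ Σ_{s'} C(s', j − r₀ + r)·C(s − s', r₀ − r)·NR (H ∩ G) r s'`. -/
theorem spFm_sub_le {G H : Finset α} {r₀ s j r : ℕ} (hG : G ⊆ gr M) (hH : H ∈ flatsTr M G r₀ s)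
    (hr : r ≤ r₀) (hj : r₀ < j) (hjs : j ≤ s) :
    spFm M G H r₀ j (r₀ - r) ≤
      ∑ s' ∈ Finset.range (s + 1), s'.choose (j - r₀ + r) * ((s - s').choose (r₀ - r) * NR M (H ∩ G) r s') := by
  obtain ⟨hHG, hHr, hHs⟩ := trace_facts_of_mem_flatsTr hG hH
  rw [spFm_eq_card_Pc hHs hjs]
  have h1 := card_Pc_sub_le hHG hHr hr (d := s - r₀) (by omega) (k := s - j) (by omega)
  rw [hHs] at h1
  refine h1.trans (Finset.sum_le_sum (fun s' _ => ?_))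
  have hidx : s - r₀ - (s - j) + r = j - r₀ + r := by omega
  rw [hidx]
  refine Nat.mul_le_mul_left _ ?_
  have h2 := BR_le (M := M) (H ∩ G) r₀ r s'
  rw [hHs] at h2
  exact h2

/-- **(T7)** the coloop classes of the traces from the flats inside them, summed over the `s`-point spanning
traces: `SPm_{s, j, r₀ − r} ≤ Σ_{s'} C(s', j − r₀ + r)·C(s − s', r₀ − r)·NRsum_{s, r, s'}` (`r ≤ r₀ < j ≤ s`). -/
theorem t7_row {G : Finset α} (hG : G ⊆ gr M) {r₀ s j r : ℕ} (hr : r ≤ r₀) (hj : r₀ < j) (hjs : j ≤ s) :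
    spSumM M G r₀ s j (r₀ - r) ≤
      ∑ s' ∈ Finset.range (s + 1), s'.choose (j - r₀ + r) * ((s - s').choose (r₀ - r) * nrSumM M G r₀ s r s') := by
  unfold spSumM nrSumM
  have hswap : ∑ s' ∈ Finset.range (s + 1), s'.choose (j - r₀ + r) *
        ((s - s').choose (r₀ - r) * ∑ H ∈ flatsTr M G r₀ s, NR M (H ∩ G) r s')
      = ∑ H ∈ flatsTr M G r₀ s, ∑ s' ∈ Finset.range (s + 1),
          s'.choose (j - r₀ + r) * ((s - s').choose (r₀ - r) * NR M (H ∩ G) r s') := by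
    simp_rw [Finset.mul_sum]
    exact Finset.sum_comm
  rw [hswap]
  exact Finset.sum_le_sum (fun H hH => spFm_sub_le hG hH hr hj hjs)

end PercRepro.Night4
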